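import Summits.ResolutionOfSingularities.ResolutionOfSingularities.Theorems.FrobeniusLadderFInjectiveMacaulayficationFullLastCentreTriSubst
import HarnessLib

/-!
# K10m-b — THE UNIT-TRIANGULAR STEP: centres cut out by letters and ONE polynomial `q = u·y_s + g` LINEAR in a non-exceptional letter `y_s` with a coefficient `u` that is a UNIT AT
# THE POINT (tri-2's non-linear cubic F-Q on bed b is of this type) are inside the typed layer — the substitution `ψ : y_s ↦ u·y_s + g` transports residual decompositions,
# orders, slacks; equi-ω chains with fibre points AND unit-triangular re-coordinatisations stay tame
# (crux `FInjectiveMacaulayfication` stmt-ResolutionOfSingularities-15315, chain w45a; desk R26.49 scoping order / tri-2 BAKEOFF rev 2.1 §F-Q; seat res-L1-w45a-lead-1 g16)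

[OURS · L1 W4.5a] Support file (`--supports stmt-ResolutionOfSingularities-15315 --as helper`); replaces the role of NO printed item; NOT a statement of any manuscript;
proves nothing of the crux; OURS counted 0. AI-written (AI review is weaker than expert review).

THE STEP. Old letters `(…, y_s, …)`, new letter `w := q = u·y_s + g` in the slot of `y_s` (`u, g ∈ k[y]` free of `y_s`, `u(0) ≠ 0`, `g(0) = 0`, `s ∉ Exc`). The straightening
`y_s = (w − g)/u` is not polynomial, but the RELATION between the discriminant `D′` in the new letters and `D` is: `ψ(D′) = u^M·D` with `ψ = tri s u g : w ↦ u·y_s + g`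
(other letters fixed) — take `b′ᵢ := u^{iM₀}·bᵢ∘ψ⁻¹`, polynomial for `M₀ ≫ 0` because `disc` is weighted-homogeneous of weight `6` (the rescaling `x′ = u^{M₀}x` is
harmless on `D(u) ∋` the point). `IsUnitTri S s u g M S′` records exactly this relation (and `Exc′ = Exc`, same defects). TRANSPORT uses only: (a) `ψ` has no constant
terms ⇒ it does not LOWER orders (`ordLE_of_ordLE_aeval`, via `MinDeg`), and `u^M` is a unit at the point (`ordLE_unit_mul`/`ordLE_of_mul`) ⇒ `ρ ≤ 8` passes from `S` to
`S′`; (b) `ψ` fixes the exceptional letters and `ψ mod y_n` is injective (`tri_injective`: a triangular substitution with non-zero `y_s`-coefficient has a left inverse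
into the fraction field) ⇒ `y_n ∣ ψ(G) ⇒ y_n ∣ G` (`X_dvd_of_X_dvd_tri`) ⇒ the residual exponent is UNCHANGED (`residual_of_unitTri`: `α′ = α`, `ψ(N′) = u^M·N`) ⇒ slacks
identical. ★ `equiTame_unitTri`; `EquiTriFibreReachable` (steps: ω-permissible chart step + arbitrary fibre point [K10j], or a unit-triangular step); ★★★
`equiTriFibreChain_cap`. (K10k's linear changes are composites of unit-triangular steps with constant `u` and linear `g`.) SCOPE AFTER K10m: centres `V(x, letters, q₁, …)` whose non-letter equations are, after a translation,
successively linear in a fresh non-exceptional letter with unit coefficient; GENUINELY OUTSIDE (power-series `Stage`, parked): smooth centres with an equation linear in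
no letter (implicit function only formal). Exponent/coefficient bookkeeping only; no named fact.
-/

-- single-problem summit: the doubled namespace component is forced
set_option linter.dupNamespace false

noncomputable section

open MvPolynomial Finsupp
open Summit.ResolutionOfSingularities.ResolutionOfSingularities.Theorems.FInjectiveMacaulayfication.LastCentreDefs
open Summit.ResolutionOfSingularities.ResolutionOfSingularities.Theorems.FInjectiveMacaulayfication.LastCentreAxisOrder
open Summit.ResolutionOfSingularities.ResolutionOfSingularities.Theorems.FInjectiveMacaulayfication.LastCentreSlack
open Summit.ResolutionOfSingularities.ResolutionOfSingularities.Theorems.FInjectiveMacaulayfication.LastCentreTame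
open Summit.ResolutionOfSingularities.ResolutionOfSingularities.Theorems.FInjectiveMacaulayfication.LastCentreTranslate
open Summit.ResolutionOfSingularities.ResolutionOfSingularities.Theorems.FInjectiveMacaulayfication.LastCentreEquiChain
open Summit.ResolutionOfSingularities.ResolutionOfSingularities.Theorems.FInjectiveMacaulayfication.LastCentreFibre
open Summit.ResolutionOfSingularities.ResolutionOfSingularities.Theorems.FInjectiveMacaulayfication.LastCentreTriSubst

namespace Summit.ResolutionOfSingularities.ResolutionOfSingularities.Theorems.FInjectiveMacaulayfication.LastCentreUnitTri

variable {k : Type} [Field k]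

/-! ## 4. The unit-triangular step of a stage -/

/-- `S′` IS `S` RE-COORDINATISED BY THE UNIT-TRIANGULAR CHANGE `w = u·y_s + g` (in the slot of `y_s`): `s` non-exceptional, `u(0) ≠ 0`, `g(0) = 0`, `u, g` free of `y_s`,
`ψ(S′.D) = u^M·S.D` for `ψ = tri s u g`, same exceptional letters, same defects. [OURS · L1 W4.5a · definition] -/
def IsUnitTri (S : Stage k) (s : Letter) (u g : YPoly k) (M : ℕ) (S' : Stage k) : Prop :=
  s ∉ S.Exc ∧ constantCoeff u ≠ 0 ∧ constantCoeff g = 0 ∧ s ∉ u.vars ∧ s ∉ g.vars ∧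
    tri s u g S'.D = u ^ M * S.D ∧ S'.Exc = S.Exc ∧ ∀ n ∈ S'.Exc, S'.d n = S.d n

/-- `tri` fixes the exceptional monomials when `s ∉ Exc`. [plumbing] -/
theorem tri_monomial_of_off {s : Letter} (a b : YPoly k) {Exc : Finset Letter} (hs : s ∉ Exc) {α : Expo} (hα : ∀ n, n ∉ Exc → α n = 0) :
    tri s a b (monomial α (1 : k)) = monomial α 1 := by
  classical
  rw [← prod_X_pow_eq_monomial, map_prod]
  refine Finset.prod_congr rfl fun n hn => ?_
  have hns : n ≠ s := by
    intro h'; subst h'; exact (Finsupp.mem_support_iff.mp hn) (hα n hs)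
  rw [map_pow, tri_X_ne s a b hns]

/-- `y_n` does not divide a polynomial with non-zero constant term. [plumbing] -/
theorem not_X_dvd_of_constantCoeff {n : Letter} {U : YPoly k} (hU : constantCoeff U ≠ 0) : ¬ (X n : YPoly k) ∣ U := by
  rintro ⟨Q, hQ⟩
  apply hU
  rw [hQ, map_mul, constantCoeff_X, zero_mul]

/-- ★ RESIDUAL TRANSPORT THROUGH A UNIT-TRIANGULAR STEP: the residual exponent is UNCHANGED and `ψ(N′) = u^M·N`. (`≤`: `y_n^{α_n+1}` cannot divide `u^M·y^α·N`;
`≥`: `y_n ∣ ψ(N′)` would force `y_n ∣ N′` by `X_dvd_of_X_dvd_tri`.) [OURS · L1 W4.5a] -/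
theorem residual_of_unitTri {S S' : Stage k} {s : Letter} {u g : YPoly k} {M : ℕ} (h : IsUnitTri S s u g M S')
    {α : Expo} {N : YPoly k} (hres : IsResidual S.Exc S.D α N) {α' : Expo} {N' : YPoly k} (hres' : IsResidual S'.Exc S'.D α' N') :
    α' = α ∧ tri s u g N' = u ^ M * N := by
  classical
  obtain ⟨hs, hu0, hg0, huv, hgv, hD, hExc, -⟩ := h
  obtain ⟨hDeq, hαoff, hNres⟩ := hres
  obtain ⟨hD'eq, hα'off, hN'res⟩ := hres'
  rw [hExc] at hα'off hN'res
  -- the transported equation: y^{α′}·ψ(N′) = u^M·y^α·N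
  have hEQ : monomial α' (1 : k) * tri s u g N' = u ^ M * (monomial α 1 * N) := by
    rw [← hDeq, ← hD, hD'eq, map_mul, tri_monomial_of_off u g hs hα'off]
  have hXp : ∀ n : Letter, Prime (X n : YPoly k) := fun n => X_prime
  -- splitting a monomial: y^β = y_n^{β n} · y^{β − β_n ε_n}
  have hsplit : ∀ (β : Expo) (n : Letter), monomial β (1 : k) = X n ^ β n * monomial (β - Finsupp.single n (β n)) 1 ∧
      (β - Finsupp.single n (β n)) n = 0 := by
    intro β n
    have hβ : Finsupp.single n (β n) + (β - Finsupp.single n (β n)) = β := by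
      ext m
      rw [Finsupp.add_apply, Finsupp.tsub_apply, Finsupp.single_apply]
      split_ifs with hm
      · subst hm; omega
      · omega
    refine ⟨?_, by rw [Finsupp.tsub_apply, Finsupp.single_eq_same, Nat.sub_self]⟩
    rw [X_pow_eq_monomial, monomial_mul, one_mul, hβ]
  have hndvd_mono : ∀ (β : Expo) (n : Letter), β n = 0 → ¬ (X n : YPoly k) ∣ monomial β (1 : k) := by
    intro β n hβ hd
    rcases X_dvd_monomial.mp hd with h1 | h1
    · exact one_ne_zero h1
    · exact h1 hβ
  have hndvd_N : ∀ n ∈ S.Exc, ¬ (X n : YPoly k) ∣ N := by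
    intro n hn
    obtain ⟨e, he, hen⟩ := hNres n hn
    exact not_X_dvd_of_free he hen
  have hndvd_N' : ∀ n ∈ S.Exc, ¬ (X n : YPoly k) ∣ N' := by
    intro n hn
    obtain ⟨e, he, hen⟩ := hN'res n hn
    exact not_X_dvd_of_free he hen
  -- α′ = α letter by letter
  have hαeq : α' = α := by
    ext n
    by_cases hn : n ∈ S.Exc
    · have hns : n ≠ s := fun h' => hs (h' ▸ hn)
      apply le_antisymm
      · -- α′_n ≤ α_n
        by_contra hlt'
        have hlt := not_le.mp hlt'
        obtain ⟨hα1, hα2⟩ := hsplit α n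
        obtain ⟨hα'1, -⟩ := hsplit α' n
        -- X n ^ (α n + 1) ∣ LHS
        have h1 : (X n : YPoly k) ^ (α n + 1) ∣ u ^ M * (monomial α 1 * N) := by
          rw [← hEQ, hα'1, mul_assoc]
          exact Dvd.dvd.mul_right (pow_dvd_pow (X n) (by omega)) _
        rw [hα1, pow_succ, show u ^ M * (X n ^ α n * monomial (α - Finsupp.single n (α n)) 1 * N) =
          X n ^ α n * (u ^ M * (monomial (α - Finsupp.single n (α n)) 1 * N)) by ring] at h1
        have h2 : (X n : YPoly k) ∣ u ^ M * (monomial (α - Finsupp.single n (α n)) 1 * N) :=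
          (mul_dvd_mul_iff_left (pow_ne_zero _ (X_ne_zero n))).mp h1
        rcases (hXp n).dvd_or_dvd h2 with h3 | h3
        · exact not_X_dvd_of_constantCoeff (by rw [map_pow]; exact pow_ne_zero _ hu0) h3
        · rcases (hXp n).dvd_or_dvd h3 with h4 | h4
          · exact hndvd_mono _ n hα2 h4
          · exact hndvd_N n hn h4
      · -- α_n ≤ α′_n
        by_contra hlt'
        have hlt := not_le.mp hlt'
        obtain ⟨hα1, -⟩ := hsplit α n
        obtain ⟨hα'1, hα'2⟩ := hsplit α' n
        have h1 : (X n : YPoly k) ^ (α' n + 1) ∣ monomial α' 1 * tri s u g N' := by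
          rw [hEQ, hα1, show u ^ M * (X n ^ α n * monomial (α - Finsupp.single n (α n)) 1 * N) =
            X n ^ α n * (u ^ M * (monomial (α - Finsupp.single n (α n)) 1 * N)) by ring]
          exact Dvd.dvd.mul_right (pow_dvd_pow (X n) (by omega)) _
        rw [hα'1, pow_succ, mul_assoc] at h1
        have h2 : (X n : YPoly k) ∣ monomial (α' - Finsupp.single n (α' n)) 1 * tri s u g N' :=
          (mul_dvd_mul_iff_left (pow_ne_zero _ (X_ne_zero n))).mp h1
        rcases (hXp n).dvd_or_dvd h2 with h3 | h3
        · exact hndvd_mono _ n hα'2 h3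
        · exact hndvd_N' n hn (X_dvd_of_X_dvd_tri hns hu0 huv hgv h3)
    · rw [hαoff n hn, hα'off n hn]
  refine ⟨hαeq, ?_⟩
  rw [hαeq, ← mul_assoc, mul_comm (u ^ M), mul_assoc] at hEQ
  exact mul_left_cancel₀ (by rw [Ne, monomial_eq_zero]; exact one_ne_zero) hEQ

/-- ★ `EquiTame` PASSES THROUGH A UNIT-TRIANGULAR STEP: `ρ ≤ 8` because `ψ` does not lower orders and `u^M` is a unit at the point; the slacks are literally the same
(`α′ = α`, same defects). [OURS · L1 W4.5a] -/
theorem equiTame_unitTri {S S' : Stage k} {s : Letter} {u g : YPoly k} {M : ℕ} (h : IsUnitTri S s u g M S')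
    {α : Expo} {N : YPoly k} (hres : IsResidual S.Exc S.D α N) (hT : EquiTame S α N)
    {α' : Expo} {N' : YPoly k} (hres' : IsResidual S'.Exc S'.D α' N') : EquiTame S' α' N' := by
  obtain ⟨hαeq, hNeq⟩ := residual_of_unitTri h hres hres'
  subst hαeq
  rcases hT with hle | hslack
  · left
    have h1 : OrdLE (u ^ M * N) 8 := ordLE_unit_mul (by rw [map_pow]; exact pow_ne_zero _ h.2.1) hle
    rw [← hNeq] at h1
    exact ordLE_of_ordLE_tri s u h.2.2.1 h1
  · right
    exact allSlackLE_mono (by rw [h.2.2.2.2.2.2.1]) h.2.2.2.2.2.2.2 (fun _ _ => rfl) hslack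

/-- A unit-triangular step kills nothing: `S′.D ≠ 0 ⇒ S.D ≠ 0`. [plumbing] -/
theorem D_ne_zero_of_unitTri {S S' : Stage k} {s : Letter} {u g : YPoly k} {M : ℕ} (h : IsUnitTri S s u g M S') (hD : S'.D ≠ 0) : S.D ≠ 0 := by
  intro hz
  have h1 := h.2.2.2.2.2.1
  rw [hz, mul_zero] at h1
  exact hD (tri_injective s (fun h0 => h.2.1 (by rw [h0, map_zero])) h.2.2.2.1 h.2.2.2.2.1 (by rw [h1, map_zero]))

/-! ## 5. Equi-ω chains with fibre points and unit-triangular re-coordinatisations -/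

/-- EQUI-ω CHAINS WITH UNIT-TRIANGULAR RE-COORDINATISATIONS: steps are (i) an ω-permissible blow-up of a coordinate centre followed by the passage to an arbitrary
fibre point (K10j), or (ii) a unit-triangular change `w = u·y_s + g` (`s` non-exceptional, `u(0) ≠ 0`) — making the next centre of F-Q type a coordinate one; the
invertible linear changes of K10k are composites of such steps with `u ∈ k×` and `g` linear (dilations and transvections generate `GL`; not re-proved here).
[OURS · L1 W4.5a · definition] -/
inductive EquiTriFibreReachable (S₀ : Stage k) : Stage k → Prop
  | refl : EquiTriFibreReachable S₀ S₀
  | step {S S' S'' : Stage k} (Nor : Finset Letter) (L : Letter) (α : Expo) (N : YPoly k) (ν : ℕ) (c : Letter → k) :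
      EquiTriFibreReachable S₀ S → L ∈ Nor → IsChart S Nor L S' → IsResidual S.Exc S.D α N →
      (∃ e ∈ N.support, norDeg Nor e = ν) → (∀ e ∈ N.support, ν ≤ norDeg Nor e) → (∃ e ∈ N.support, tdeg e = ν) →
      IsTranslate S' c S'' → (∀ m, m ∉ Nor.erase L → c m = 0) → EquiTriFibreReachable S₀ S''
  | tri {S S' : Stage k} (s : Letter) (u g : YPoly k) (M : ℕ) :
      EquiTriFibreReachable S₀ S → IsUnitTri S s u g M S' → EquiTriFibreReachable S₀ S'

/-- Along such a chain from an exceptional-free germ every residual decomposition of every stage with `D ≠ 0` is `EquiTame`. [OURS · plumbing] -/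
theorem equiTame_of_equiTriFibreReachable {S₀ S : Stage k} (hExc : S₀.Exc = ∅) (h : EquiTriFibreReachable S₀ S) (hD : S.D ≠ 0)
    {α : Expo} {N : YPoly k} (hres : IsResidual S.Exc S.D α N) : EquiTame S α N := by
  induction h generalizing α N with
  | refl => right; intro n hn; rw [hExc] at hn; exact absurd hn (Finset.notMem_empty n)
  | @step S S' S'' Nor L α₀ N₀ ν c _ hL hch hres₀ hν₁ hν₂ hequi htr hc ih =>
    have hD0 : S.D ≠ 0 := D_ne_zero_of_residual hres₀ (by obtain ⟨e, he, -⟩ := hν₁; exact ⟨e, he⟩)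
    exact equiTame_fibre_step hL hch hres₀ hν₁ hν₂ hequi htr hc hres (ih hD0 hres₀)
  | @tri S S' s u g M _ htri ih =>
    have hD0 : S.D ≠ 0 := D_ne_zero_of_unitTri htri hD
    obtain ⟨α₀, N₀, hres₀⟩ := LastCentreResidual.exists_isResidual S.Exc S.D hD0
    exact equiTame_unitTri htri hres₀ (ih hD0 hres₀) hres

/-- ★★★ EQUI-ω CHAINS WITH FIBRE POINTS AND UNIT-TRIANGULAR RE-COORDINATISATIONS ARE TAME: from an exceptional-free germ, along any `EquiTriFibreReachable` chain, every
stage carrying the drop-point budget has `ρ ≤ 8` for every residual decomposition — the typed cap for ω-permissible rules whose centres are, at every image point,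
coordinate after translations and unit-triangular changes (F-Q-type non-linear centres included). [OURS · L1 W4.5a] -/
theorem equiTriFibreChain_cap {S₀ S : Stage k} (hExc : S₀.Exc = ∅) (hreach : EquiTriFibreReachable S₀ S) (hbud : DropBudget S)
    {α : Expo} {N : YPoly k} (hres : IsResidual S.Exc S.D α N) : OrdLE N 8 := by
  have hD : S.D ≠ 0 := by
    rw [hres.1]
    refine mul_ne_zero (by rw [Ne, monomial_eq_zero]; exact one_ne_zero) fun hz => ?_
    obtain ⟨f, hf, -⟩ := hbud
    rw [hres.1, hz, mul_zero, MvPolynomial.support_zero] at hf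
    exact Finset.notMem_empty f hf
  rcases equiTame_of_equiTriFibreReachable hExc hreach hD hres with hle | hslack
  · exact hle
  · exact ordLE_eight_of_allSlackLE_dropBudget hres hslack hbud


/-! ## 6. The residual order is monotone along equi-ω steps and invariant under re-coordinatisations (TRACK E's first termination component) -/

/-- ★ `ρ` DOES NOT INCREASE THROUGH AN ω-PERMISSIBLE STEP, AT ANY FIBRE POINT: `ord₀ N ≤ m ⇒ ord N″ ≤ m` (since `ν ≤ ρ ≤ m` and the fibre no-rise law gives `ρ″ ≤ ν`).
[OURS · L1 W4.5a] -/
theorem ordLE_equi_fibre_mono {S S' S'' : Stage k} {Nor : Finset Letter} {L : Letter} {α α'' : Expo} {N N'' : YPoly k} {c : Letter → k}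
    (hL : L ∈ Nor) (hch : IsChart S Nor L S') (hres : IsResidual S.Exc S.D α N)
    {ν : ℕ} (hν₁ : ∃ e ∈ N.support, norDeg Nor e = ν) (hν₂ : ∀ e ∈ N.support, ν ≤ norDeg Nor e) (hequi : ∃ e ∈ N.support, tdeg e = ν)
    (htr : IsTranslate S' c S'') (hc : ∀ m, m ∉ Nor.erase L → c m = 0) (hres'' : IsResidual S''.Exc S''.D α'' N'')
    {m : ℕ} (hm : OrdLE N m) : OrdLE N'' m := by
  have hD' : S'.D ≠ 0 := D_ne_zero_of_chart hch (D_ne_zero_of_residual hres (by obtain ⟨e, he, -⟩ := hν₁; exact ⟨e, he⟩))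
  obtain ⟨α', N', hres'⟩ := LastCentreResidual.exists_isResidual S'.Exc S'.D hD'
  obtain ⟨e, he, hem⟩ := hm
  have hνm : ν ≤ m := ((hν₂ e he).trans (norDeg_le_tdeg Nor e)).trans hem
  exact ordLE_mono (ordLE_of_equi_fibre hL hch hres hres' hν₁ hν₂ hequi htr hc hres'') hνm

/-- `ρ` IS INVARIANT (upper bounds are kept) under a unit-triangular re-coordinatisation. [OURS · L1 W4.5a] -/
theorem ordLE_unitTri_mono {S S' : Stage k} {s : Letter} {u g : YPoly k} {M : ℕ} (h : IsUnitTri S s u g M S')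
    {α : Expo} {N : YPoly k} (hres : IsResidual S.Exc S.D α N) {α' : Expo} {N' : YPoly k} (hres' : IsResidual S'.Exc S'.D α' N')
    {m : ℕ} (hm : OrdLE N m) : OrdLE N' m := by
  obtain ⟨-, hNeq⟩ := residual_of_unitTri h hres hres'
  have h1 : OrdLE (u ^ M * N) m := ordLE_unit_mul (by rw [map_pow]; exact pow_ne_zero _ h.2.1) hm
  rw [← hNeq] at h1
  exact ordLE_of_ordLE_tri s u h.2.2.1 h1

/-- ★ ALONG AN `EquiTriFibreReachable` CHAIN THE RESIDUAL ORDER NEVER INCREASES: an upper bound `ρ ≤ m` at a stage persists at every later stage (every residual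
decomposition). This is the first component of any termination measure for TRACK E; what it does not give is strict descent. [OURS · L1 W4.5a] -/
theorem ordLE_of_equiTriFibreReachable {S₀ S : Stage k} (h : EquiTriFibreReachable S₀ S) (hD : S.D ≠ 0)
    {α₀ : Expo} {N₀ : YPoly k} (hres₀ : IsResidual S₀.Exc S₀.D α₀ N₀) {m : ℕ} (hm : OrdLE N₀ m)
    {α : Expo} {N : YPoly k} (hres : IsResidual S.Exc S.D α N) : OrdLE N m := by
  induction h generalizing α N with
  | refl =>
    obtain ⟨-, hNeq⟩ := residual_unique hres₀ hres
    rw [← hNeq]; exact hm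
  | @step S S' S'' Nor L α₁ N₁ ν c _ hL hch hres₁ hν₁ hν₂ hequi htr hc ih =>
    have hD1 : S.D ≠ 0 := D_ne_zero_of_residual hres₁ (by obtain ⟨e, he, -⟩ := hν₁; exact ⟨e, he⟩)
    exact ordLE_equi_fibre_mono hL hch hres₁ hν₁ hν₂ hequi htr hc hres (ih hD1 hres₁)
  | @tri S S' s u g M _ htri ih =>
    have hD1 : S.D ≠ 0 := D_ne_zero_of_unitTri htri hD
    obtain ⟨α₁, N₁, hres₁⟩ := LastCentreResidual.exists_isResidual S.Exc S.D hD1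
    exact ordLE_unitTri_mono htri hres₁ hres (ih hD1 hres₁)

end Summit.ResolutionOfSingularities.ResolutionOfSingularities.Theorems.FInjectiveMacaulayfication.LastCentreUnitTri

end
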